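import Summits.NavierStokesRegularity.NavierStokesRegularity.Theorems.ExtremiserTransienceNearExtremalTransienceExtremiserLiouvilleConstantSpeedL2Liouville
import Literature.Analysis.FluidPDE.IsometryInvariance
import Mathlib.Analysis.InnerProductSpace.Projection.Reflection
import HarnessLib

/-!
# Crux `ExtremiserTransience.NearExtremalTransience` (stmt-NavierStokesRegularity-21883), line `extremiser_liouville`,
# stub K1b — L² FLUX LIOUVILLE, general far-field direction (rotation reduction)

`--supports stmt-NavierStokesRegularity-21883` (helper).  Author: prover seat `ns-el-k1b` (g3).

`eq_farField_of_constSpeed_of_sq_integrable`: **a `C¹` divergence-free field on `ℝ³` with constant speed `‖w‖ ≡ M = ‖c‖`,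
`c ≠ 0`, and `∫‖w − c‖² < ∞` is the constant `c`** — the axial case `…ConstantSpeedL2Liouville` conjugated by the
reflection `R` with `R c = ‖c‖·e₃` (`reflection_sub`; `VectorCalculus.IsDivFree.conj_linearIsometryEquiv`;
`LinearIsometryEquiv.measurePreserving`).  CONSEQUENCE for K1b: the residue object (constant-speed analytic extended
extremiser with far field `c`, `M > 0`, `Z > 0`) satisfies **`∫‖w − c‖² = ∞`**; in particular it has no `|x|^{-k}` tail with
`k > 3/2` (no rotlet tail).

WHAT THIS IS NOT: K1b is NOT proved (open: `w − c ∈ L²` for the residue object, or the exclusion of tails between `|x|⁻¹`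
and `|x|^{-3/2}`); nothing here proves NS regularity. [folklore]
-/

noncomputable section

open Set Filter Topology MeasureTheory Metric Function
open scoped ENNReal NNReal Topology InnerProductSpace RealInnerProductSpace ContDiff
open Literature.Analysis.FluidPDE Literature.Analysis

namespace Summit.NavierStokesRegularity.NavierStokesRegularity.Theorems

-- the problem directory repeats the summit name (`NavierStokesRegularity/NavierStokesRegularity`)
set_option linter.dupNamespace false

namespace ExtremiserLiouville

/-- **L² flux Liouville, general direction.**  If `w ∈ C¹(ℝ³;ℝ³)` is divergence free with `‖w‖ ≡ M = ‖c‖`, `c ≠ 0`, and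
`‖w − c‖² ∈ L¹`, then `w ≡ c`. [folklore] -/
theorem eq_farField_of_constSpeed_of_sq_integrable {w : EuclideanSpace ℝ (Fin 3) → EuclideanSpace ℝ (Fin 3)}
    (hw : ContDiff ℝ 1 w) (hdiv : VectorCalculus.IsDivFree w) {M : ℝ} {c : EuclideanSpace ℝ (Fin 3)}
    (hM : ∀ x, ‖w x‖ = M) (hcM : ‖c‖ = M) (hc : c ≠ 0)
    (hL2 : Integrable (fun x => ‖w x - c‖ ^ 2) volume) : ∀ x, w x = c := by
  -- the reflection taking `c` to `‖c‖ e₃`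
  set e : EuclideanSpace ℝ (Fin 3) := ‖c‖ • EuclideanSpace.single (2 : Fin 3) (1 : ℝ) with he
  have hce : ‖c‖ = ‖e‖ := by
    rw [he, norm_smul, Real.norm_eq_abs, abs_of_nonneg (norm_nonneg _), PiLp.norm_single, norm_one, mul_one]
  set R : EuclideanSpace ℝ (Fin 3) ≃ₗᵢ[ℝ] EuclideanSpace ℝ (Fin 3) := Submodule.reflection (ℝ ∙ (c - e))ᗮ with hR
  have hRc : R c = e := Submodule.reflection_sub hce
  -- the conjugated field
  set w' : EuclideanSpace ℝ (Fin 3) → EuclideanSpace ℝ (Fin 3) := fun y => R (w (R.symm y)) with hw'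
  have hw'1 : ContDiff ℝ 1 w' :=
    R.toContinuousLinearEquiv.contDiff.comp (hw.comp R.symm.toContinuousLinearEquiv.contDiff)
  have hdiv' : VectorCalculus.IsDivFree w' := hdiv.conj_linearIsometryEquiv R
  have hM' : ∀ x, ‖w' x‖ = M := fun x => by rw [hw', R.norm_map, hM]
  have heM : ‖e‖ = M := by rw [← hce, hcM]
  have he0 : e 0 = 0 := by simp [he]
  have he1 : e 1 = 0 := by simp [he]
  have he2 : e 2 ≠ 0 := by
    have : e 2 = ‖c‖ := by simp [he]
    rw [this]; exact norm_ne_zero_iff.2 hc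
  -- `‖w' − e‖² = ‖w − c‖² ∘ R⁻¹` is integrable (`R⁻¹` preserves Lebesgue measure)
  have hL2' : Integrable (fun x => ‖w' x - e‖ ^ 2) volume := by
    have heq : (fun x => ‖w' x - e‖ ^ 2) = (fun x => ‖w x - c‖ ^ 2) ∘ R.symm := by
      funext x
      simp only [Function.comp, hw']
      rw [← hRc, ← map_sub, R.norm_map]
    rw [heq]
    exact (R.symm.measurePreserving.integrable_comp hL2.aestronglyMeasurable).2 hL2
  have h := eq_farField_of_constSpeed_of_sq_integrable_axial hw'1 hdiv' hM' heM he0 he1 he2 hL2'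
  intro x
  have hx := h (R x)
  simp only [hw', LinearIsometryEquiv.symm_apply_apply] at hx
  rw [← hRc] at hx
  exact R.injective hx

end ExtremiserLiouville

end Summit.NavierStokesRegularity.NavierStokesRegularity.Theorems

end
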